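import Summits.ResolutionOfSingularities.ResolutionOfSingularities.Theorems.PurelyInseparableDim4PointTreeWalk
import Summits.ResolutionOfSingularities.ResolutionOfSingularities.Theorems.PurelyInseparableDim4EquimultipleScope
import HarnessLib

/-!
# Purely inseparable four-folds: CERTIFIABLE finiteness — univariate witnesses in the Hasse–Schmidt ideal `J_p⁺` make
# the root set and the branching of the point-centre walk finite (brick TY-3k part 9 «WITNESSES», cell `res-dim4-pi`)

[OURS · counted 0] (D-0157 DOOR 2; makes the finiteness hypotheses of `Equimultiple.exists_isMarkedResolution_of_walk`
checkable by explicit algebraic certificates; host item stmt-ResolutionOfSingularities-16155, helper). Resolution of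
singularities in dimension ≥ 4 / characteristic `p` is NOT proved here or anywhere in this programme.

The walk form asks (roots) that only finitely many `b ∈ K⁴` kill every non-constant monomial of degree `< p` of
`F(x + b)` — i.e. `b ∈ V(J_p⁺(F))(K)` for the desk's Hasse–Schmidt ideal `J_p⁺ = PIDim4.singLocusIdeal p` — and
(branching) that at every reachable state `s` only finitely many pairs `(j, b)`, `b_j = 0`, are equimultiple — i.e.
`b ∈ V(J_p⁺(F′_j) + (x_j))(K)`. Both are implied by UNIVARIATE WITNESSES: for every variable `x_i` a non-zero
polynomial `g_i(x_i)` lying in the ideal (each coordinate of a zero is then a root of `g_i`). Such witnesses are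
ideal-membership identities with explicit cofactors, i.e. kernel-checkable by `ring`/`decide` in concrete instances.

* `eval_eq_zero_of_aeval_X_mem`, `finite_of_univariate` — the mechanism;
* `singLocusIdeal_le_vanishingIdeal_of_roots` — a root parameter `b` is a `K`-point of `V(J_p⁺(F))`;
* **`finite_roots_of_witnesses`**, **`finite_pairs_of_witnesses`** — the two finiteness hypotheses from witnesses;
* **`exists_isMarkedResolution_of_witnesses`** — the walk form with both finiteness hypotheses replaced by witnesses.

AI-produced formalisation, weaker than expert review. bears_on: LADDER-RESOLUTION:D157-DOOR2 (res-dim4-pi · TY-3k).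
-/

set_option linter.dupNamespace false -- D-0017: single-problem summit path `Summit.<S>.<S>.…` by design

noncomputable section

open MvPolynomial Finset CategoryTheory AlgebraicGeometry Opposite TopologicalSpace

namespace Summit.ResolutionOfSingularities.ResolutionOfSingularities.Theorems.PIDim4

open Literature.AlgebraicGeometry.Resolution
open Literature.AlgebraicGeometry.Resolution.Hauser2010
open Literature.AlgebraicGeometry.Resolution.AffinePointBlowup (P A γ coord Wtop ξ)

namespace Equimultiple

section Witness

variable {K : Type} [Field K] {p : ℕ} [hp : Fact p.Prime] [CharP K p]

omit hp [CharP K p] in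
/-- **A univariate member of an ideal vanishing at `b` has `b_i` as a root**: if `J ⊆ 𝔪_b` and `g(x_i) ∈ J` then
`g(b_i) = 0`. [folklore] -/
theorem eval_eq_zero_of_aeval_X_mem {b : Fin 4 → K} {J : Ideal (MvPolynomial (Fin 4) K)}
    (hJ : J ≤ MvPolynomial.vanishingIdeal K {b}) {i : Fin 4} {g : Polynomial K}
    (hg : Polynomial.aeval (X i : MvPolynomial (Fin 4) K) g ∈ J) : g.eval (b i) = 0 := by
  have h := (MvPolynomial.mem_vanishingIdeal_singleton_iff b _).mp (hJ hg)
  rwa [← Polynomial.aeval_algHom_apply, MvPolynomial.aeval_X, Polynomial.coe_aeval_eq_eval] at h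

omit hp [CharP K p] in
/-- **Finitely many points all of whose coordinates are roots of fixed non-zero univariate polynomials.** [folklore] -/
theorem finite_of_univariate (g : Fin 4 → Polynomial K) (hg : ∀ i, g i ≠ 0) :
    {b : Fin 4 → K | ∀ i, (g i).eval (b i) = 0}.Finite := by
  classical
  refine (Set.Finite.pi (t := fun i => ((g i).roots.toFinset : Set K)) fun i => (g i).roots.toFinset.finite_toSet).subset
    fun b hb => ?_
  rw [Set.mem_univ_pi]
  intro i
  rw [Finset.mem_coe, Multiset.mem_toFinset, Polynomial.mem_roots (hg i)]
  exact hb i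

omit hp [CharP K p] in
/-- **A root parameter is a `K`-point of `V(J_p⁺(F))`**: if every non-constant monomial of degree `< p` of `F(x + b)`
vanishes then `J_p⁺(F) ⊆ 𝔪_b` (Taylor: `coeff_α F(x + b) = (D^{(α)} F)(b)`). [cite: EGAIV4, Thm. 16.11.2 (16.11.2.1)]
[cite: CossartPiltant2019, Prop. 2.55 (Hasse derivatives and the locus of multiplicity)] -/
theorem singLocusIdeal_le_vanishingIdeal_of_roots (F : MvPolynomial (Fin 4) K) (b : Fin 4 → K)
    (H : ∀ d : Fin 4 →₀ ℕ, d ≠ 0 → d.degree < p → coeff d (PointBlowup.translate b F) = 0) :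
    singLocusIdeal p F ≤ MvPolynomial.vanishingIdeal K {b} := by
  rw [singLocusIdeal]
  refine Ideal.span_le.mpr ?_
  rintro G ⟨α, hα0, hαq, rfl⟩
  rw [SetLike.mem_coe, MvPolynomial.mem_vanishingIdeal_singleton_iff, hasseDeriv_eq]
  change MvPolynomial.eval b _ = 0
  rw [← coeff_translate_eq_eval_hasseDeriv]
  exact H α (fun h => (pos_iff_ne_zero.mp hα0) (by rw [h, map_zero])) hαq

omit hp [CharP K p] in
/-- **Univariate witnesses in `J_p⁺(F)` ⇒ finitely many root parameters.** If for every variable `x_i` some non-zero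
`g_i(x_i)` lies in `J_p⁺(F)`, then only finitely many `b ∈ K⁴` kill every non-constant monomial of degree `< p` of
`F(x + b)`. [cite: CossartPiltant2019, Prop. 2.55] -/
theorem finite_roots_of_witnesses (F : MvPolynomial (Fin 4) K) (g : Fin 4 → Polynomial K) (hg0 : ∀ i, g i ≠ 0)
    (hg : ∀ i, Polynomial.aeval (X i : MvPolynomial (Fin 4) K) (g i) ∈ singLocusIdeal p F) :
    {b : Fin 4 → K | ∀ d : Fin 4 →₀ ℕ, d ≠ 0 → d.degree < p → coeff d (PointBlowup.translate b F) = 0}.Finite :=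
  (finite_of_univariate g hg0).subset fun b hb i =>
    eval_eq_zero_of_aeval_X_mem (singLocusIdeal_le_vanishingIdeal_of_roots F b hb) (hg i)

omit hp [CharP K p] in
/-- **Univariate witnesses in `J_p⁺(F′_j) + (x_j)` ⇒ finite branching at `s`.** If for every chart `x_j` and every
variable `x_i`, `i ≠ j`, some non-zero `g_{j,i}(x_i)` lies in `J_p⁺(F′_j) + (x_j)` (`F′_j` the chart transform of `s.F`),
then only finitely many pairs `(j, b)`, `b_j = 0`, are equimultiple points of the walk at `s`.
[cite: Hauser2010, §F (equiconstant points)] [cite: CossartPiltant2019, Prop. 2.55] -/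
theorem finite_pairs_of_witnesses [DecidableEq K] (s : State K) (g : Fin 4 → Fin 4 → Polynomial K)
    (hg0 : ∀ j i, i ≠ j → g j i ≠ 0)
    (hg : ∀ j i, i ≠ j → Polynomial.aeval (X i : MvPolynomial (Fin 4) K) (g j i) ∈
      singLocusIdeal p (CentreBlowup.chartTransform p Finset.univ j s.F) ⊔ Ideal.span {(X j : MvPolynomial (Fin 4) K)}) :
    {jb : Fin 4 × (Fin 4 → K) | jb.2 jb.1 = 0 ∧
      CentreBlowup.IsEquimultiplePoint p Finset.univ jb.1 jb.2 s}.Finite := by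
  -- per chart `j`: the coordinates of an equimultiple `b` are roots of `x` (at `j`) or of `g j i`
  let g' : Fin 4 → Fin 4 → Polynomial K := fun j i => if i = j then Polynomial.X else g j i
  have hg'0 : ∀ j i, g' j i ≠ 0 := by
    intro j i
    by_cases hij : i = j
    · simp only [g', if_pos hij]
      exact Polynomial.X_ne_zero
    · simp only [g', if_neg hij]
      exact hg0 j i hij
  have hB : ∀ j, {b : Fin 4 → K | ∀ i, (g' j i).eval (b i) = 0}.Finite := fun j => finite_of_univariate (g' j) (hg'0 j)
  refine (Set.finite_iUnion fun j : Fin 4 => (Set.finite_singleton j).prod (hB j)).subset ?_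
  rintro ⟨j, b⟩ ⟨hbj, heq⟩
  rw [Set.mem_iUnion]
  refine ⟨j, Set.mk_mem_prod rfl fun i => ?_⟩
  by_cases hij : i = j
  · subst hij
    simp only [g', if_pos rfl, Polynomial.eval_X]
    exact hbj
  · simp only [g', if_neg hij]
    have hJ : singLocusIdeal p (CentreBlowup.chartTransform p Finset.univ j s.F) ⊔
        Ideal.span {(X j : MvPolynomial (Fin 4) K)} ≤ MvPolynomial.vanishingIdeal K {b} := by
      refine sup_le ((singLocusIdeal_le_vanishingIdeal_iff p Finset.univ j b s).mpr heq) ?_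
      rw [Ideal.span_le, Set.singleton_subset_iff, SetLike.mem_coe, MvPolynomial.mem_vanishingIdeal_singleton_iff,
        MvPolynomial.aeval_X]
      exact hbj
    exact eval_eq_zero_of_aeval_X_mem hJ (hg j i hij)

/-- **TERMINATION ⇒ ORDER REDUCTION with CERTIFIABLE finiteness.** `K = K̄` of characteristic `p`, `F ≠ 0` clean;
univariate witnesses in `J_p⁺(F)` (roots) and, at every state reachable from a re-centred root state, univariate
witnesses in `J_p⁺(F′_j) + (x_j)` for every chart (branching); and the point-centre walk well-founded below every root
state. Then `(𝔸⁵_K, (z^p + F)·𝒪, [], p)` admits a marked resolution. NOT `OrderReduction p`.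
[cite: BierstoneGrigorievMilmanWlodarczyk2011, Def. 3.1.3] [cite: Hauser2010, §§F–G]
[cite: Hironaka1964, Main Theorem I (the characteristic-zero statement whose analogue is asked)] -/
theorem exists_isMarkedResolution_of_witnesses [IsAlgClosed K] [DecidableEq K] (F : MvPolynomial (Fin 4) K)
    (hF : F ≠ 0) (hclean : Literature.Barriers.ResolutionOfSingularities.HauserPerlega.IsClean p F)
    (g₀ : Fin 4 → Polynomial K) (hg₀0 : ∀ i, g₀ i ≠ 0)
    (hg₀ : ∀ i, Polynomial.aeval (X i : MvPolynomial (Fin 4) K) (g₀ i) ∈ singLocusIdeal p F)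
    (hwalk : ∀ b : Fin 4 → K, (∀ d : Fin 4 →₀ ℕ, d ≠ 0 → d.degree < p → coeff d (PointBlowup.translate b F) = 0) →
      Acc (fun s' s : State K => Edge p Finset.univ s s')
          (⟨deletePthPowers p (PointBlowup.translate b F), 0, ∅⟩ : State K) ∧
        ∀ s' : State K, Relation.ReflTransGen (fun a c : State K => Edge p Finset.univ a c)
            (⟨deletePthPowers p (PointBlowup.translate b F), 0, ∅⟩ : State K) s' →
          ∃ g : Fin 4 → Fin 4 → Polynomial K, (∀ j i, i ≠ j → g j i ≠ 0) ∧
            ∀ j i, i ≠ j → Polynomial.aeval (X i : MvPolynomial (Fin 4) K) (g j i) ∈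
              singLocusIdeal p (CentreBlowup.chartTransform p Finset.univ j s'.F) ⊔
                Ideal.span {(X j : MvPolynomial (Fin 4) K)}) :
    ∃ (X' : Scheme.{0}) (π : X' ⟶ P 4 K) (M' : MarkedIdeal X'),
      IsMarkedResolution (⟨hypSheaf p F, [], p⟩ : MarkedIdeal (P 4 K)) π M' := by
  refine exists_isMarkedResolution_of_walk F hF hclean (finite_roots_of_witnesses F g₀ hg₀0 hg₀) fun b H =>
    ⟨(hwalk b H).1, fun s' hs' => ?_⟩
  obtain ⟨g, hg0, hg⟩ := (hwalk b H).2 s' hs'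
  exact finite_pairs_of_witnesses s' g hg0 hg

/-! ## Termination certificates: a RANKED set of states closed under edges -/

omit hp [CharP K p] in
/-- **A RANKING CERTIFIES TERMINATION BELOW A STATE** (appended). If `T` is a set of states containing `s₀`, closed
under the edge relation, and carrying a rank `T → ℕ` that drops along every edge, then the point-centre walk below
`s₀` is well-founded (`Acc` of the flipped `Edge p univ`) — the shape of a finite TREE CERTIFICATE (nodes = `T`,
rank = height). Termination is a property of the tree of `s₀`, never of the field. [folklore] -/
theorem acc_edge_of_rank [DecidableEq K] {T : Set (State K)} (rank : State K → ℕ)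
    (hT : ∀ s ∈ T, ∀ s' : State K, Edge p Finset.univ s s' → s' ∈ T ∧ rank s' < rank s) {s₀ : State K}
    (h₀ : s₀ ∈ T) : Acc (fun s' s : State K => Edge p Finset.univ s s') s₀ := by
  have key : ∀ n : ℕ, ∀ s ∈ T, rank s ≤ n → Acc (fun s' s : State K => Edge p Finset.univ s s') s := by
    intro n
    induction n with
    | zero =>
      intro s hs hn
      exact Acc.intro s fun s' hedge => absurd (hT s hs s' hedge).2 (by omega)
    | succ n ih =>
      intro s hs hn
      exact Acc.intro s fun s' hedge => ih s' (hT s hs s' hedge).1 (by have := (hT s hs s' hedge).2; omega)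
  exact key (rank s₀) s₀ h₀ le_rfl

omit hp [CharP K p] in
/-- Edge-closed sets contain everything reachable. [folklore] -/
theorem mem_of_reflTransGen_edge [DecidableEq K] {T : Set (State K)}
    (hT : ∀ s ∈ T, ∀ s' : State K, Edge p Finset.univ s s' → s' ∈ T) {s₀ s : State K} (h₀ : s₀ ∈ T)
    (h : Relation.ReflTransGen (fun a c : State K => Edge p Finset.univ a c) s₀ s) : s ∈ T := by
  induction h with
  | refl => exact h₀
  | tail _ hedge ih => exact hT _ ih _ hedge

/-- **TERMINATION ⇒ ORDER REDUCTION from a TREE CERTIFICATE.** `K = K̄` of characteristic `p`, `F ≠ 0` clean, univariate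
witnesses in `J_p⁺(F)` (finitely many roots); and for every root parameter `b` a CERTIFICATE: a set `T` of states
containing the re-centred root state, closed under edges, with a rank dropping along every edge (termination) and
univariate witnesses in `J_p⁺(F′_j) + (x_j)` at every state of `T` (finite branching). Then
`(𝔸⁵_K, (z^p + F)·𝒪, [], p)` admits a marked resolution. NOT `OrderReduction p`.
[cite: BierstoneGrigorievMilmanWlodarczyk2011, Def. 3.1.3] [cite: Hauser2010, §§F–G]
[cite: Hironaka1964, Main Theorem I (the characteristic-zero statement whose analogue is asked)] -/
theorem exists_isMarkedResolution_of_certificate [IsAlgClosed K] [DecidableEq K] (F : MvPolynomial (Fin 4) K)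
    (hF : F ≠ 0) (hclean : Literature.Barriers.ResolutionOfSingularities.HauserPerlega.IsClean p F)
    (g₀ : Fin 4 → Polynomial K) (hg₀0 : ∀ i, g₀ i ≠ 0)
    (hg₀ : ∀ i, Polynomial.aeval (X i : MvPolynomial (Fin 4) K) (g₀ i) ∈ singLocusIdeal p F)
    (hcert : ∀ b : Fin 4 → K, (∀ d : Fin 4 →₀ ℕ, d ≠ 0 → d.degree < p → coeff d (PointBlowup.translate b F) = 0) →
      ∃ (T : Set (State K)) (rank : State K → ℕ),
        (⟨deletePthPowers p (PointBlowup.translate b F), 0, ∅⟩ : State K) ∈ T ∧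
        (∀ s ∈ T, ∀ s' : State K, Edge p Finset.univ s s' → s' ∈ T ∧ rank s' < rank s) ∧
        ∀ s ∈ T, ∃ g : Fin 4 → Fin 4 → Polynomial K, (∀ j i, i ≠ j → g j i ≠ 0) ∧
          ∀ j i, i ≠ j → Polynomial.aeval (X i : MvPolynomial (Fin 4) K) (g j i) ∈
            singLocusIdeal p (CentreBlowup.chartTransform p Finset.univ j s.F) ⊔
              Ideal.span {(X j : MvPolynomial (Fin 4) K)}) :
    ∃ (X' : Scheme.{0}) (π : X' ⟶ P 4 K) (M' : MarkedIdeal X'),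
      IsMarkedResolution (⟨hypSheaf p F, [], p⟩ : MarkedIdeal (P 4 K)) π M' := by
  refine exists_isMarkedResolution_of_witnesses F hF hclean g₀ hg₀0 hg₀ fun b H => ?_
  obtain ⟨T, rank, h₀, hT, hwit⟩ := hcert b H
  exact ⟨acc_edge_of_rank rank hT h₀, fun s' hs' =>
    hwit s' (mem_of_reflTransGen_edge (fun s hs s' he => (hT s hs s' he).1) h₀ hs')⟩

/-! ## Root lists: the successors of a state come from an explicit finite candidate box -/

omit hp [CharP K p] in
/-- **EDGE CANDIDATES FROM ROOT LISTS** (appended). If for every chart `x_j` and every `i ≠ j` a univariate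
`g_{j,i}(x_i) ∈ J_p⁺(F′_j) + (x_j)` is given together with a finite list `R_{j,i} ⊆ K` containing all its roots, then
every edge successor of `s` is `step p univ j b s` for a `b` in the finite CANDIDATE BOX `b_j = 0`, `b_i ∈ R_{j,i}`:
the closure and rank conditions of a tree certificate become finite conjunctions. [cite: Hauser2010, §F]
[cite: CossartPiltant2019, Prop. 2.55] -/
theorem edge_candidates [DecidableEq K] (s : State K) (g : Fin 4 → Fin 4 → Polynomial K)
    (R : Fin 4 → Fin 4 → Finset K)
    (hg : ∀ j i, i ≠ j → Polynomial.aeval (X i : MvPolynomial (Fin 4) K) (g j i) ∈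
      singLocusIdeal p (CentreBlowup.chartTransform p Finset.univ j s.F) ⊔ Ideal.span {(X j : MvPolynomial (Fin 4) K)})
    (hR : ∀ j i, i ≠ j → ∀ x : K, (g j i).eval x = 0 → x ∈ R j i) {s' : State K}
    (h : Edge p Finset.univ s s') :
    ∃ (j : Fin 4) (b : Fin 4 → K), (∀ i, i ≠ j → b i ∈ R j i) ∧ b j = 0 ∧
      CentreBlowup.IsEquimultiplePoint p Finset.univ j b s ∧ s' = CentreBlowup.step p Finset.univ j b s := by
  obtain ⟨j, b, -, hbj, heq, -, hs'⟩ := h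
  refine ⟨j, b, fun i hij => hR j i hij (b i) ?_, hbj, heq, hs'⟩
  have hJ : singLocusIdeal p (CentreBlowup.chartTransform p Finset.univ j s.F) ⊔
      Ideal.span {(X j : MvPolynomial (Fin 4) K)} ≤ MvPolynomial.vanishingIdeal K {b} := by
    refine sup_le ((singLocusIdeal_le_vanishingIdeal_iff p Finset.univ j b s).mpr heq) ?_
    rw [Ideal.span_le, Set.singleton_subset_iff, SetLike.mem_coe, MvPolynomial.mem_vanishingIdeal_singleton_iff,
      MvPolynomial.aeval_X]
    exact hbj
  exact eval_eq_zero_of_aeval_X_mem hJ (hg j i hij)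

omit hp [CharP K p] in
/-- **ROOT CANDIDATES FROM ROOT LISTS** (appended): with univariate `g_i(x_i) ∈ J_p⁺(F)` and finite lists `R_i ⊆ K` of
their roots, every root parameter `b` lies in the box `b_i ∈ R_i`. [cite: CossartPiltant2019, Prop. 2.55] -/
theorem root_candidates (F : MvPolynomial (Fin 4) K) (g : Fin 4 → Polynomial K) (R : Fin 4 → Finset K)
    (hg : ∀ i, Polynomial.aeval (X i : MvPolynomial (Fin 4) K) (g i) ∈ singLocusIdeal p F)
    (hR : ∀ i, ∀ x : K, (g i).eval x = 0 → x ∈ R i) {b : Fin 4 → K}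
    (H : ∀ d : Fin 4 →₀ ℕ, d ≠ 0 → d.degree < p → coeff d (PointBlowup.translate b F) = 0) :
    ∀ i, b i ∈ R i := fun i =>
  hR i (b i) (eval_eq_zero_of_aeval_X_mem (singLocusIdeal_le_vanishingIdeal_of_roots F b H) (hg i))

/-- **TERMINATION ⇒ ORDER REDUCTION from a FINITE-DATA certificate.** `K = K̄` of characteristic `p`, `F ≠ 0` clean;
univariate witnesses in `J_p⁺(F)` with root lists `R_i`; and for every `b` in the root box `b_i ∈ R_i` that IS a root
parameter: a set `T` of states with a rank, containing the re-centred root state, and at every `s ∈ T` chart witnesses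
with root lists such that EVERY candidate successor (`b′_j = 0`, `b′_i ∈ R_{j,i}`, equimultiple) lies in `T` with
smaller rank. Then `(𝔸⁵_K, (z^p + F)·𝒪, [], p)` admits a marked resolution. All data finite; all side conditions
ideal memberships, root lists and equimultiplicity tests. NOT `OrderReduction p`.
[cite: BierstoneGrigorievMilmanWlodarczyk2011, Def. 3.1.3] [cite: Hauser2010, §§F–G]
[cite: Hironaka1964, Main Theorem I (the characteristic-zero statement whose analogue is asked)] -/
theorem exists_isMarkedResolution_of_rootListCertificate [IsAlgClosed K] [DecidableEq K]
    (F : MvPolynomial (Fin 4) K) (hF : F ≠ 0)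
    (hclean : Literature.Barriers.ResolutionOfSingularities.HauserPerlega.IsClean p F)
    (g₀ : Fin 4 → Polynomial K) (R₀ : Fin 4 → Finset K) (hg₀0 : ∀ i, g₀ i ≠ 0)
    (hg₀ : ∀ i, Polynomial.aeval (X i : MvPolynomial (Fin 4) K) (g₀ i) ∈ singLocusIdeal p F)
    (hR₀ : ∀ i, ∀ x : K, (g₀ i).eval x = 0 → x ∈ R₀ i)
    (hcert : ∀ b : Fin 4 → K, (∀ i, b i ∈ R₀ i) →
      (∀ d : Fin 4 →₀ ℕ, d ≠ 0 → d.degree < p → coeff d (PointBlowup.translate b F) = 0) →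
      ∃ (T : Set (State K)) (rank : State K → ℕ),
        (⟨deletePthPowers p (PointBlowup.translate b F), 0, ∅⟩ : State K) ∈ T ∧
        ∀ s ∈ T, ∃ (g : Fin 4 → Fin 4 → Polynomial K) (R : Fin 4 → Fin 4 → Finset K),
          (∀ j i, i ≠ j → g j i ≠ 0) ∧
          (∀ j i, i ≠ j → Polynomial.aeval (X i : MvPolynomial (Fin 4) K) (g j i) ∈
            singLocusIdeal p (CentreBlowup.chartTransform p Finset.univ j s.F) ⊔
              Ideal.span {(X j : MvPolynomial (Fin 4) K)}) ∧
          (∀ j i, i ≠ j → ∀ x : K, (g j i).eval x = 0 → x ∈ R j i) ∧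
          ∀ (j : Fin 4) (b' : Fin 4 → K), (∀ i, i ≠ j → b' i ∈ R j i) → b' j = 0 →
            CentreBlowup.IsEquimultiplePoint p Finset.univ j b' s →
              CentreBlowup.step p Finset.univ j b' s ∈ T ∧
                rank (CentreBlowup.step p Finset.univ j b' s) < rank s) :
    ∃ (X' : Scheme.{0}) (π : X' ⟶ P 4 K) (M' : MarkedIdeal X'),
      IsMarkedResolution (⟨hypSheaf p F, [], p⟩ : MarkedIdeal (P 4 K)) π M' := by
  refine exists_isMarkedResolution_of_certificate F hF hclean g₀ hg₀0 hg₀ fun b H => ?_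
  obtain ⟨T, rank, h₀, hT⟩ := hcert b (root_candidates F g₀ R₀ hg₀ hR₀ H) H
  refine ⟨T, rank, h₀, fun s hs s' hedge => ?_, fun s hs => ?_⟩
  · obtain ⟨g, R, -, hg, hR, hclosed⟩ := hT s hs
    obtain ⟨j, b', hb', hbj, heq, rfl⟩ := edge_candidates s g R hg hR hedge
    exact hclosed j b' hb' hbj heq
  · obtain ⟨g, R, hg0, hg, -, -⟩ := hT s hs
    exact ⟨g, hg0, hg⟩

end Witness

end Equimultiple

end Summit.ResolutionOfSingularities.ResolutionOfSingularities.Theorems.PIDim4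

end
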